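import Literature.MathematicalPhysics.QuantumFieldTheory.Balaban1983to89.B4Lower18RegularRegion

/-!
# [B4] Lemma 2.1 (2.15) at `A ≠ 0`: the four `L²` bounds for `G_k(□,A)`, `D^η_{A,μ}G_k`, `G_kD^{η*}_{A,μ}`,
# `D^η_{A,μ}G_kD^{η*}_{A,ν}` on an arbitrary finite union of unit blocks, for a (1.7)-regular field

Source: T. Bałaban, *Regularity and decay of lattice Green's functions*, Commun. Math. Phys. **89** (1983)
571–597 [cite: Balaban1983RegularityDecay], Lemma 2.1 p. 577 and its proof pp. 579–580.

## PRINTED TEXT (verbatim, from the cell transcript)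

Lemma 2.1: «Let a set □ be an arbitrary sum of unit blocks, but such that it is a sum of at most few large blocks,
and let A be as in the theorem. Then for e sufficiently small we have»
(2.15) `‖G_k(□,A)f‖₂, ‖D^η_{A,μ}G_k(□,A)f‖₂, ‖G_k(□,A)D^{η*}_{A,μ}f‖₂, ‖D^η_{A,μ}G_k(□,A)D^{η*}_{A,ν}f‖₂ ≤ c₂‖f‖₂.`
Proof, p. 580: «From these representations and (2.25) we get easily the inequalities (2.15).» … «Now these bounds
are consequences of quadratic form considerations.» … «Further we have»
(2.29) `‖∂^η_μG_k^{1/2}(□,0)f‖₂² = ⟨f, G_k^{1/2}(□,0)∂^{η*}_μ∂^η_μG_k^{1/2}(□,0)f⟩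
≤ ⟨f, G_k^{1/2}(□,0)(−Δ^{η,N}_□ + m_k² + a_kP_k)G_k^{1/2}(□,0)f⟩ = ‖f‖₂²`,
«hence ‖∂^η_μG_k^{1/2}(□,0)‖_{2,2} = ‖G_k^{1/2}(□,0)∂^{η*}_μ‖_{2,2} ≤ 1, and this together with (2.28) imply the
bounds (2.25). Thus the Lemma 2.1 is proved.»

## THE ROUTE CERTIFIED HERE (quadratic forms, no operator square roots, directly at `A ≠ 0`)

The printed proof expands `G_k(□,A)` around a constant background ((2.23)–(2.26)) and proves (2.25) at `A₀ = 0` by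
(2.27)–(2.29).  The predecessor nodes of this cell already certify the lower bound (1.8) for the FULL operator
`H = −Δ^{η,N}_{A,□} + m² + a_kP_k(A)` at `A ≠ 0` on an arbitrary finite union `□` of unit blocks
(`B4Lower18RegularRegion.lower18_regular_region_printed`: `H ≥ (min(2,a)/4 + m²)·I` under (1.7) and
`e ≤ e₁`).  Given that, (2.15) follows from (2.29)-type «quadratic form considerations» applied to `H` itself —
no expansion, no square roots: with `γ = min(2,a)/4 + m²`, `G = H⁻¹`, and `D_μ = D^η_{A,μ}` satisfying the operator
inequality `D_μ^*D_μ ≤ H` (the direction-`μ` bonds are among the bonds of (1.3); `m² ≥ 0`, `a_kP_k ≥ 0`),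
* `γ²‖Gf‖² ≤ ‖f‖²` (node `B4Lower18Regular.inv_mulVec_sq_le`);
* `γ‖D_μGf‖² ≤ ‖f‖²`: `‖D_μu‖² ≤ ⟨u,Hu⟩ = ⟨u,f⟩ ≤ γ⁻¹‖f‖²`, `u = Gf`;
* `γ‖GD_μ^*g‖² ≤ ‖g‖²` and `‖D_μGD_ν^*g‖² ≤ ‖g‖²`: for `u = GD_ν^*g`, `⟨u,Hu⟩ = ⟨D_νu, g⟩ ≤ ‖D_νu‖‖g‖` and
  `‖D_νu‖² ≤ ⟨u,Hu⟩`, whence `‖D_νu‖ ≤ ‖g‖`, `⟨u,Hu⟩ ≤ ‖g‖²`, `γ‖u‖² ≤ ‖g‖²`, `‖D_μu‖² ≤ ‖g‖²`.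
Hence (2.15) with `c₂ = max(γ⁻¹, γ^{-1/2}, 1) ≤ 4/min(2,a)` (as `γ ≥ min(2,a)/4` and `min(2,a)/4 ≤ 1/2`).
`H` is NOT assumed symmetric (it is, but the argument does not need it); `D^{η*}` is the `ℓ²` adjoint (transpose).

## DICTIONARY

* lattice units: fine points `x ∈ ℤ^{d+1}` of mesh `η = 1/n` (`n ≥ 1`), `□` = `fineDom n Ωc` = the fine points over a
  finite set `Ωc` of unit labels (an ARBITRARY finite union of unit blocks); fields `Φ : □ × ι → ℝ` (`ℝ^N`-valued,
  `N = |ι|`); link variables `U(eηA_b) = F.U((e/n)·A_b)` for an orthogonal flow `F` (`U(t) = e^{tq}`), with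
  `|U(t) − 1| ≤ ℓ|t|` as the only analytic input (`ℓ = 1` for the rotation flow, `N = 2`);
* the vector field in component form `A_ν(x)` ↦ the bond function `compField` (antisymmetric: `A_{⟨y,x⟩} = −A_{⟨x,y⟩}`,
  so `U(A_{⟨y,x⟩}) = U(A_{⟨x,y⟩})ᵀ`, `fieldLink_rev`);
* `D^η_{A,μ}` ↦ `covDeriv n R W μ` (§2; value `n(Wφ(x+e_μ) − φ(x))` on bonds inside `R`, `0` at sites whose `μ`-bond
  leaves `R` — Neumann), `regionDeriv` for the region data; `‖D^η_{A,μ}φ‖² = ⟨φ, −Δ_{dirWt μ}φ⟩` (`covDeriv_form`) and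
  `Σ_μ` of these is (1.3) (here only `≤`, `covDeriv_sq_le_covLap_form`, is needed and certified);
* `H = −Δ^{η,N}_{A,□} + m² + a_kP_k(A)` ↦ `regionOp F e hn a m2 Ωc Ac` = the `b4Op` of `B4GaugeCovariance` with the
  (1.3) weights `regWt` (`n²/2` per ordered nearest-neighbour pair = `n²` per bond), `a_k = a·n^{-(d+1)}`, the block
  weights / base points / staircase contours of `B4Lower18RegularRegion`; `G_k(□,A) = H⁻¹` (`Matrix.inv`; `H` is
  invertible by coercivity, `B4Lower18Regular.isUnit_det_of_form_ge`);
* `‖·‖₂` ↦ the counting-measure `ℓ²` norm `√(f ⬝ᵥ f)` ((2.15) is homogeneous of degree one: the weight `η^{d+1}` of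
  the printed `L²` norm cancels).

## WHAT IS CERTIFIED (sorry-free; axioms `propext`, `Classical.choice`, `Quot.sound`)

* §1 `deriv_green_sq_le`, `green_derivT_sq_le`, `deriv_green_derivT_sq_le` (+ `inv_mulVec_sq_le` of node
  `B4Lower18Regular`): the four bounds for ANY real matrix `H ≥ γ > 0` (forms) and derivatives with `DᵀD ≤ H`;
* §2 `covDeriv`, `covDeriv_form`, `covDeriv_sq_le_covLap_form`: `‖D^η_{W,μ}φ‖² ≤ ⟨φ,(−Δ_W)φ⟩` on any region for
  orthogonal, transposition-reversing link variables (symmetrisation over bond orientations, `bond_sq_rev`);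
* §3 `covDeriv_sq_le_b4Op_form` (`D_μ^*D_μ ≤ H` at `A ≠ 0`), and the four REGION THEOREMS `green_sq_le_region`,
  `deriv_green_sq_le_region`, `green_derivT_sq_le_region`, `deriv_green_derivT_sq_le_region`: (2.15) with
  `γ = min(2,a)/4 + m²` on an arbitrary finite union of unit blocks, every mesh `n ≥ 1`, every `d`, every `N`, under
  the printed regularity (1.7) `|A_ν(x+e_μ) − A_ν(x)| ≤ c e^{β−1}/n` on `□` and the smallness
  `ℓ²((d+1)c e^β)²(d+1)(1 + a(d+1)) ≤ min(2,a)/4`;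
* §4 `lemma21Printed_regularRegion` / `lemma21Printed_regularRegion_rot`: the cell's typed statement
  `B4.Lemma21Printed` DISCHARGED on the family `regularCube F a c β M K` of ALL regular-field regions (instances =
  (mesh, `Ωc`, charge, vector field, mass `m² ≥ 0`), NO built-in hypothesis), with `c₂ = 4/min(2,a)` and the
  threshold `e₁` of `B4Lower18Regular.threshold_exists` chosen before the instance; `linInst_meets`: for EVERY
  `e₁ > 0`, `M, K ≥ 1`, mesh and mass, a NON-CONSTANT linear field meets all antecedents (few large blocks, regular,
  `0 < e ≤ e₁`) — the typed headline is not vacuous and genuinely concerns `A ≠ 0`.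

## HONEST SCOPE / DIVERGENCE LEDGER

* (D1) ROUTE: the certificate does not follow the printed expansion (2.23)–(2.26) (constant background + Neumann
  series in `A'` with `G^{1/2}`); it applies the (2.29) quadratic-form argument to the full operator, resting on the
  node-3 lower bound (1.8) at `A ≠ 0` (itself proved by blockwise constant backgrounds and decoupling, see that file's
  ledger).  Same statement, different (shorter) proof; constants explicit: `c₂ = 4/min(2,a)`.
* (D2) «few large blocks» is typed on the carrier (`fewLargeBlocks`: `□` a union of `M`-blocks with at most `K`
  labels) but NOT USED: our bound is uniform in `□`.  In print the restriction enters through `c'` of (2.23)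
  («c' depends on c and M»), which the blockwise route avoids.  This is a strengthening, flagged, not hidden.
* (D3) `a_k`: we certify every `a > 0` with `a_k = a·n^{-(d+1)}` in lattice units (the printed `a_k` is a fixed
  sequence from paper I, (1.5), not transcribed in this cell); `m² ≥ 0` is arbitrary (the printed `m_k²` of (1.6) is
  one value); the printed `c₂` is an unspecified constant — ours is `4/min(2,a)`.
* (D4) (1.7) is read in lattice units with the discrete forward difference, `|A_ν(x+e_μ) − A_ν(x)| ≤ c e^{β−1}·η`,
  i.e. `|∂^η_μA_ν| ≤ c e^{β−1}`; the sup bound on `|A|` of Proposition I.2.1 is NOT needed (only differences of `A`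
  enter, by gauge covariance — node `B4GaugeCovariance`).
* (D5) the smallness of `e` is the explicit polynomial threshold of node 2/3, not the paper's unspecified
  «for e sufficiently small»; `U` is any orthogonal one-parameter flow with `|U(t) − 1| ≤ ℓ|t|` (for `U = e^{tq}`,
  `ℓ = |q|`); the rotation instance (`N = 2`) is hypothesis-free.
* (D6) CARRIER: `holder1` (the Hölder norm (2.14) along contours) is NOT modelled (set to `0`) and `rect`,
  `constNearBdry`, `supNorm`, `lpNorm`, `opLq` are definitions only — `B4.Lemma22Printed` (Lemma 2.2, the `L^p` and
  Hölder bounds (2.16)–(2.17)) is NOT certified here and must not be read on `regularCube`; the zero-field corner of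
  Lemma 2.2 is the business of `B4Lemma21Zero`/`B4Cor23Zero` (not imported).
* (D7) `ℓ²` adjoint: `D^{η*}_{A,μ}` is the transpose for the counting inner product; with the weighted inner product
  of the paper the adjoint differs by the constant factor `η^{d+1}` on both sides of (2.15)₃,₄ consistently, so the
  printed and the typed inequalities coincide.

Value = kernel certificate of a published lemma ([B4] Lemma 2.1) in typed form at non-zero field, on top of the
cell's nodes 1–3; NOT summit progress.
-/

namespace Literature.MathematicalPhysics.QuantumFieldTheory.Balaban1983to89.B4Lemma21Region

open Matrix Finset
open Literature.MathematicalPhysics.QuantumFieldTheory.Balaban1983to89.B4GaugeCovariance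
open Literature.MathematicalPhysics.QuantumFieldTheory.Balaban1983to89.B4Lower18Regular
open Literature.MathematicalPhysics.QuantumFieldTheory.Balaban1983to89.B4Lower18RegularRegion

section Generic

/-! ## §1 Quadratic-form lemmas: `H ≥ γ`, `DᵀD ≤ H` ⇒ the four `L²` bounds of (2.15)

The abstract content of [B4] p. 580 (2.28)–(2.29) («Further we have» `‖∂^η_μG_k^{1/2}(□,0)f‖₂² = ⟨f,
G_k^{1/2}(□,0)∂^{η*}_μ∂^η_μG_k^{1/2}(□,0)f⟩ ≤ ⟨f, G_k^{1/2}(□,0)(−Δ^{η,N}_□ + m_k² + a_kP_k)G_k^{1/2}(□,0)f⟩ = ‖f‖₂²`),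
written WITHOUT operator square roots: for a real matrix `H` with `⟨v, Hv⟩ ≥ γ|v|²` (`γ > 0`) and "derivatives"
`D, D₁, D₂` dominated by the form, `|Dv|² ≤ ⟨v, Hv⟩`, the Green's function `G = H⁻¹` obeys
`γ²|Gf|² ≤ |f|²`, `γ|DGf|² ≤ |f|²`, `γ|GDᵀg|² ≤ |g|²`, `|D₁GD₂ᵀg|² ≤ |g|²`.  No symmetry of `H` is needed. -/

variable {S T T₁ T₂ : Type*} [Fintype S] [Fintype T] [Fintype T₁] [Fintype T₂] [DecidableEq S]

/-- `H(H⁻¹f) = f` for a coercive matrix `H`. [folklore] -/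
theorem mulVec_inv_mulVec {H : Matrix S S ℝ} {γ : ℝ} (hγ : 0 < γ) (h : ∀ v, γ * (v ⬝ᵥ v) ≤ v ⬝ᵥ (H *ᵥ v))
    (f : S → ℝ) : H *ᵥ (H⁻¹ *ᵥ f) = f := by
  rw [Matrix.mulVec_mulVec, Matrix.mul_nonsing_inv _ (isUnit_det_of_form_ge hγ h), Matrix.one_mulVec]

/-- Cauchy–Schwarz for the dot product: `⟨v,w⟩² ≤ |v|²|w|²`. [folklore] -/
theorem dotProduct_sq_le (v w : T → ℝ) : (v ⬝ᵥ w) ^ 2 ≤ (v ⬝ᵥ v) * (w ⬝ᵥ w) := by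
  have := Finset.sum_mul_sq_le_sq_mul_sq Finset.univ v w
  simpa [dotProduct, sq] using this

/-- if `0 ≤ p ≤ s` and `s² ≤ p·q` (`q ≥ 0`) then `p ≤ q`. [folklore] -/
theorem le_of_le_of_sq_le_mul {p s q : ℝ} (hp : 0 ≤ p) (hq : 0 ≤ q) (h1 : p ≤ s) (h2 : s ^ 2 ≤ p * q) :
    p ≤ q := by
  rcases hp.eq_or_lt with h0 | hpos
  · rw [← h0]; exact hq
  · have h3 : p ^ 2 ≤ s ^ 2 := pow_le_pow_left₀ hp h1 2
    have h4 : p * p ≤ p * q := by nlinarith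
    exact le_of_mul_le_mul_left h4 hpos

/-- **(2.15)₂ abstractly**: `γ|DH⁻¹f|² ≤ |f|²` (from `|Du|² ≤ ⟨u,Hu⟩ = ⟨u,f⟩ ≤ γ⁻¹|f|²`, `u = H⁻¹f`).
[cite: Balaban1983RegularityDecay, p. 580 (2.29)] -/
theorem deriv_green_sq_le {H : Matrix S S ℝ} {γ : ℝ} (hγ : 0 < γ) (h : ∀ v, γ * (v ⬝ᵥ v) ≤ v ⬝ᵥ (H *ᵥ v))
    {D : Matrix T S ℝ} (hD : ∀ v, (D *ᵥ v) ⬝ᵥ (D *ᵥ v) ≤ v ⬝ᵥ (H *ᵥ v)) (f : S → ℝ) :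
    γ * ((D *ᵥ (H⁻¹ *ᵥ f)) ⬝ᵥ (D *ᵥ (H⁻¹ *ᵥ f))) ≤ f ⬝ᵥ f := by
  have h1 := hD (H⁻¹ *ᵥ f)
  rw [mulVec_inv_mulVec hγ h] at h1
  have h2 := inv_mulVec_dotProduct_le hγ h f
  calc γ * ((D *ᵥ (H⁻¹ *ᵥ f)) ⬝ᵥ (D *ᵥ (H⁻¹ *ᵥ f))) ≤ γ * (γ⁻¹ * (f ⬝ᵥ f)) :=
        mul_le_mul_of_nonneg_left (h1.trans h2) hγ.le
    _ = f ⬝ᵥ f := by rw [← mul_assoc, mul_inv_cancel₀ hγ.ne', one_mul]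

/-- the energy identity for `u = H⁻¹Dᵀg`: `⟨u, Hu⟩ = ⟨Du, g⟩`. [folklore] -/
theorem inv_derivT_energy {H : Matrix S S ℝ} {γ : ℝ} (hγ : 0 < γ) (h : ∀ v, γ * (v ⬝ᵥ v) ≤ v ⬝ᵥ (H *ᵥ v))
    (D : Matrix T S ℝ) (g : T → ℝ) :
    (H⁻¹ *ᵥ (Dᵀ *ᵥ g)) ⬝ᵥ (H *ᵥ (H⁻¹ *ᵥ (Dᵀ *ᵥ g))) = (D *ᵥ (H⁻¹ *ᵥ (Dᵀ *ᵥ g))) ⬝ᵥ g := by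
  rw [mulVec_inv_mulVec hγ h, Matrix.dotProduct_mulVec, Matrix.vecMul_transpose]

/-- `|DH⁻¹Dᵀg|² ≤ |g|²` (one derivative): `|Du|² ≤ ⟨u,Hu⟩ = ⟨Du,g⟩ ≤ |Du||g|`, `u = H⁻¹Dᵀg`.
[cite: Balaban1983RegularityDecay, p. 580 (2.29)] -/
theorem deriv_green_derivT_sq_le_self {H : Matrix S S ℝ} {γ : ℝ} (hγ : 0 < γ)
    (h : ∀ v, γ * (v ⬝ᵥ v) ≤ v ⬝ᵥ (H *ᵥ v)) {D : Matrix T S ℝ}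
    (hD : ∀ v, (D *ᵥ v) ⬝ᵥ (D *ᵥ v) ≤ v ⬝ᵥ (H *ᵥ v)) (g : T → ℝ) :
    (D *ᵥ (H⁻¹ *ᵥ (Dᵀ *ᵥ g))) ⬝ᵥ (D *ᵥ (H⁻¹ *ᵥ (Dᵀ *ᵥ g))) ≤ g ⬝ᵥ g := by
  have e := inv_derivT_energy hγ h D g
  set u := H⁻¹ *ᵥ (Dᵀ *ᵥ g) with hu
  have h1 : (D *ᵥ u) ⬝ᵥ (D *ᵥ u) ≤ (D *ᵥ u) ⬝ᵥ g := (hD u).trans_eq e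
  exact le_of_le_of_sq_le_mul (dotProduct_self_nonneg' _) (dotProduct_self_nonneg' _) h1 (dotProduct_sq_le _ _)

/-- `⟨DH⁻¹Dᵀg, g⟩ ≤ |g|²` for `u = H⁻¹Dᵀg`. [folklore] -/
theorem deriv_green_derivT_pair_le {H : Matrix S S ℝ} {γ : ℝ} (hγ : 0 < γ)
    (h : ∀ v, γ * (v ⬝ᵥ v) ≤ v ⬝ᵥ (H *ᵥ v)) {D : Matrix T S ℝ}
    (hD : ∀ v, (D *ᵥ v) ⬝ᵥ (D *ᵥ v) ≤ v ⬝ᵥ (H *ᵥ v)) (g : T → ℝ) :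
    (D *ᵥ (H⁻¹ *ᵥ (Dᵀ *ᵥ g))) ⬝ᵥ g ≤ g ⬝ᵥ g := by
  have e := inv_derivT_energy hγ h D g
  have h2 := deriv_green_derivT_sq_le_self hγ h hD g
  set u := H⁻¹ *ᵥ (Dᵀ *ᵥ g) with hu
  have hs : 0 ≤ (D *ᵥ u) ⬝ᵥ g := by
    rw [← e]; exact le_trans (mul_nonneg hγ.le (dotProduct_self_nonneg' u)) (h u)
  have h3 : ((D *ᵥ u) ⬝ᵥ g) ^ 2 ≤ (g ⬝ᵥ g) ^ 2 :=
    calc ((D *ᵥ u) ⬝ᵥ g) ^ 2 ≤ ((D *ᵥ u) ⬝ᵥ (D *ᵥ u)) * (g ⬝ᵥ g) := dotProduct_sq_le _ _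
      _ ≤ (g ⬝ᵥ g) * (g ⬝ᵥ g) := mul_le_mul_of_nonneg_right h2 (dotProduct_self_nonneg' g)
      _ = (g ⬝ᵥ g) ^ 2 := (sq _).symm
  exact (pow_le_pow_iff_left₀ hs (dotProduct_self_nonneg' g) two_ne_zero).1 h3

/-- **(2.15)₃ abstractly**: `γ|H⁻¹Dᵀg|² ≤ |g|²` (`γ|u|² ≤ ⟨u,Hu⟩ = ⟨Du,g⟩ ≤ |g|²`).
[cite: Balaban1983RegularityDecay, p. 580 (2.29)] -/
theorem green_derivT_sq_le {H : Matrix S S ℝ} {γ : ℝ} (hγ : 0 < γ) (h : ∀ v, γ * (v ⬝ᵥ v) ≤ v ⬝ᵥ (H *ᵥ v))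
    {D : Matrix T S ℝ} (hD : ∀ v, (D *ᵥ v) ⬝ᵥ (D *ᵥ v) ≤ v ⬝ᵥ (H *ᵥ v)) (g : T → ℝ) :
    γ * ((H⁻¹ *ᵥ (Dᵀ *ᵥ g)) ⬝ᵥ (H⁻¹ *ᵥ (Dᵀ *ᵥ g))) ≤ g ⬝ᵥ g := by
  have e := inv_derivT_energy hγ h D g
  have h4 := deriv_green_derivT_pair_le hγ h hD g
  exact ((h _).trans_eq e).trans h4

/-- **(2.15)₄ abstractly**: `|D₁H⁻¹D₂ᵀg|² ≤ |g|²` (`|D₁u|² ≤ ⟨u,Hu⟩ = ⟨D₂u,g⟩ ≤ |g|²`, `u = H⁻¹D₂ᵀg`).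
[cite: Balaban1983RegularityDecay, p. 580 (2.29)] -/
theorem deriv_green_derivT_sq_le {H : Matrix S S ℝ} {γ : ℝ} (hγ : 0 < γ)
    (h : ∀ v, γ * (v ⬝ᵥ v) ≤ v ⬝ᵥ (H *ᵥ v)) {D₁ : Matrix T₁ S ℝ} {D₂ : Matrix T₂ S ℝ}
    (hD₁ : ∀ v, (D₁ *ᵥ v) ⬝ᵥ (D₁ *ᵥ v) ≤ v ⬝ᵥ (H *ᵥ v))
    (hD₂ : ∀ v, (D₂ *ᵥ v) ⬝ᵥ (D₂ *ᵥ v) ≤ v ⬝ᵥ (H *ᵥ v)) (g : T₂ → ℝ) :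
    (D₁ *ᵥ (H⁻¹ *ᵥ (D₂ᵀ *ᵥ g))) ⬝ᵥ (D₁ *ᵥ (H⁻¹ *ᵥ (D₂ᵀ *ᵥ g))) ≤ g ⬝ᵥ g := by
  have e := inv_derivT_energy hγ h D₂ g
  have h4 := deriv_green_derivT_pair_le hγ h hD₂ g
  exact ((hD₁ _).trans_eq e).trans h4

end Generic

section Deriv

/-! ## §2 The covariant derivative `D^η_{W,μ}` along direction `μ` on a region, and its domination by (1.3) -/

open Literature.MathematicalPhysics.QuantumFieldTheory.Balaban1983to89.B4Reflection242 (nbrs mem_nbrs)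

variable {d : ℕ} {ι : Type*} [Fintype ι] [DecidableEq ι]

/-- THE BOND WEIGHTS OF DIRECTION `μ` on a region `R` (lattice units): `n²` on the ordered pairs `(x, x + e_μ)` with
both ends in `R`, `0` otherwise — the bonds summed in `‖D^η_{A,μ}φ‖₂²`.
[cite: Balaban1983RegularityDecay, p. 572 (1.3), dictionary] -/
noncomputable def dirWt (n : ℕ) (R : Finset (Fin (d + 1) → ℤ)) (μ : Fin (d + 1)) : ↥R → ↥R → ℝ :=
  fun x y => if y.1 = x.1 + e1 μ then (n : ℝ) ^ 2 else 0

/-- the block kernel of `D^η_{W,μ}`: row `x` is `n·(W(x, x+e_μ)φ(x+e_μ) − φ(x))` if `x + e_μ ∈ R`, else `0`.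
[cite: Balaban1983RegularityDecay, p. 572 (1.3), dictionary] -/
noncomputable def dirKer (n : ℕ) (R : Finset (Fin (d + 1) → ℤ)) (W : ↥R → ↥R → Matrix ι ι ℝ)
    (μ : Fin (d + 1)) (x z : ↥R) : Matrix ι ι ℝ :=
  if x.1 + e1 μ ∈ R then (n : ℝ) • ((if z.1 = x.1 + e1 μ then W x z else 0) - (if z = x then 1 else 0))
  else 0

/-- **THE COVARIANT DERIVATIVE `D^η_{A,μ}` OF [B4] (1.3)** along direction `μ` on the region `R` with link variables
`W` (`W = U(A_b)`): `(D^η_{A,μ}φ)(x) = η^{-1}(U(A_{⟨x,x+ηe_μ⟩})φ(x + ηe_μ) − φ(x))` for the bond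
`⟨x, x + ηe_μ⟩ ⊂ R`, and `0` when `x + ηe_μ ∉ R` (Neumann conditions: only bonds with both end-points in the region
enter (1.3)); lattice units, `η^{-1} = n`. [cite: Balaban1983RegularityDecay, p. 572 (1.3)] -/
noncomputable def covDeriv (n : ℕ) (R : Finset (Fin (d + 1) → ℤ)) (W : ↥R → ↥R → Matrix ι ι ℝ)
    (μ : Fin (d + 1)) : Matrix (↥R × ι) (↥R × ι) ℝ :=
  blockOp (dirKer n R W μ)

/-- `D^η_{W,μ}φ` at a site whose `μ`-bond lies in the region. [cite: Balaban1983RegularityDecay, p. 572 (1.3)] -/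
theorem fld_covDeriv_mulVec_of_mem (n : ℕ) {R : Finset (Fin (d + 1) → ℤ)} (W : ↥R → ↥R → Matrix ι ι ℝ)
    {μ : Fin (d + 1)} (Φ : ↥R × ι → ℝ) {x : ↥R} (h : x.1 + e1 μ ∈ R) :
    fld (covDeriv n R W μ *ᵥ Φ) x
      = (n : ℝ) • (W x ⟨x.1 + e1 μ, h⟩ *ᵥ fld Φ ⟨x.1 + e1 μ, h⟩ - fld Φ x) := by
  rw [covDeriv, fld_blockOp_mulVec]
  have hK : ∀ z : ↥R, dirKer n R W μ x z *ᵥ fld Φ z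
      = (n : ℝ) • ((if z.1 = x.1 + e1 μ then W x z *ᵥ fld Φ z else 0) - (if z = x then fld Φ z else 0)) := by
    intro z
    rw [dirKer, if_pos h, Matrix.smul_mulVec, Matrix.sub_mulVec]
    congr 2
    · split_ifs <;> simp
    · split_ifs <;> simp
  simp_rw [hK]
  rw [← Finset.smul_sum, Finset.sum_sub_distrib, Finset.sum_ite_eq' Finset.univ x, if_pos (Finset.mem_univ _)]
  congr 2
  rw [Finset.sum_eq_single ⟨x.1 + e1 μ, h⟩]
  · rw [if_pos rfl]
  · intro z _ hz
    rw [if_neg]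
    intro hz1
    exact hz (Subtype.ext hz1)
  · intro hh; exact absurd (Finset.mem_univ _) hh

/-- no bond, no derivative (Neumann boundary condition). [cite: Balaban1983RegularityDecay, p. 572 (1.3)] -/
theorem fld_covDeriv_mulVec_of_not_mem (n : ℕ) {R : Finset (Fin (d + 1) → ℤ)} (W : ↥R → ↥R → Matrix ι ι ℝ)
    {μ : Fin (d + 1)} (Φ : ↥R × ι → ℝ) {x : ↥R} (h : x.1 + e1 μ ∉ R) :
    fld (covDeriv n R W μ *ᵥ Φ) x = 0 := by
  rw [covDeriv, fld_blockOp_mulVec]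
  refine Finset.sum_eq_zero fun z _ => ?_
  rw [dirKer, if_neg h, Matrix.zero_mulVec]

/-- **`‖D^η_{W,μ}φ‖² = Σ_{⟨x,x+e_μ⟩⊂R} n²|W φ(x+e_μ) − φ(x)|²`** — the direction-`μ` part of (1.3), as the quadratic
form of the covariant Laplacian with the weights `dirWt`. [cite: Balaban1983RegularityDecay, p. 572 (1.3)] -/
theorem covDeriv_form (n : ℕ) (R : Finset (Fin (d + 1) → ℤ)) (W : ↥R → ↥R → Matrix ι ι ℝ) (μ : Fin (d + 1))
    (Φ : ↥R × ι → ℝ) :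
    (covDeriv n R W μ *ᵥ Φ) ⬝ᵥ (covDeriv n R W μ *ᵥ Φ) = Φ ⬝ᵥ (covLap (dirWt n R μ) W *ᵥ Φ) := by
  rw [dotProduct_eq_sum_fld, covLap_form]
  refine Finset.sum_congr rfl fun x _ => ?_
  by_cases h : x.1 + e1 μ ∈ R
  · rw [fld_covDeriv_mulVec_of_mem n W Φ h, Finset.sum_eq_single ⟨x.1 + e1 μ, h⟩]
    · rw [dirWt, if_pos rfl, smul_dotProduct, dotProduct_smul, smul_eq_mul, smul_eq_mul]
      ring
    · intro y _ hy
      rw [dirWt, if_neg, zero_mul]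
      intro hy1
      exact hy (Subtype.ext hy1)
    · intro hh; exact absurd (Finset.mem_univ _) hh
  · rw [fld_covDeriv_mulVec_of_not_mem n W Φ h, zero_dotProduct]
    symm
    refine Finset.sum_eq_zero fun y _ => ?_
    rw [dirWt, if_neg, zero_mul]
    intro hy1
    exact h (hy1 ▸ y.2)

/-- reversing an orthogonal bond: `|Wᵀu − v|² = |Wv − u|²`. [folklore] -/
theorem bond_sq_rev {W₁ W₂ : Matrix ι ι ℝ} (hT : W₂ = W₁ᵀ) (hO : W₁ᵀ * W₁ = 1) (u v : ι → ℝ) :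
    (W₂ *ᵥ u - v) ⬝ᵥ (W₂ *ᵥ u - v) = (W₁ *ᵥ v - u) ⬝ᵥ (W₁ *ᵥ v - u) := by
  subst hT
  have hO' : W₁ * W₁ᵀ = 1 := mul_eq_one_comm.1 hO
  have h1 : W₁ᵀ *ᵥ u - v = W₁ᵀ *ᵥ (u - W₁ *ᵥ v) := by
    rw [Matrix.mulVec_sub, Matrix.mulVec_mulVec, hO, Matrix.one_mulVec]
  have hO'' : (W₁ᵀ)ᵀ * W₁ᵀ = 1 := by rw [Matrix.transpose_transpose]; exact hO'
  rw [h1, orth_dotProduct_mulVec_self hO'' (u - W₁ *ᵥ v), ← neg_sub (W₁ *ᵥ v) u, neg_dotProduct,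
    dotProduct_neg, neg_neg]

/-- two opposite orientations of one bond carry total weight `n² = 2·(n²/2)`; no other pair is weighted.
[folklore] -/
theorem dirWt_add_rev_le (n : ℕ) (R : Finset (Fin (d + 1) → ℤ)) (μ : Fin (d + 1)) (x y : ↥R) :
    dirWt n R μ x y + dirWt n R μ y x ≤ 2 * regWt n R x y := by
  by_cases h1 : y.1 = x.1 + e1 μ
  · have h2 : ¬ (x.1 = y.1 + e1 μ) := by
      intro h2; rw [h1] at h2; exact ne_add_e1_add_e1 x.1 μ μ h2
    have hn : y.1 ∈ nbrs x.1 := mem_nbrs.2 ⟨μ, Or.inl h1⟩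
    simp only [dirWt, regWt, if_pos h1, if_neg h2, if_pos hn]
    linarith
  · by_cases h2 : x.1 = y.1 + e1 μ
    · have hn : y.1 ∈ nbrs x.1 := mem_nbrs.2 ⟨μ, Or.inr (eq_sub_of_add_eq h2.symm)⟩
      simp only [dirWt, regWt, if_neg h1, if_pos h2, if_pos hn]
      linarith
    · simp only [dirWt, if_neg h1, if_neg h2, add_zero]
      exact mul_nonneg zero_le_two (regWt_nonneg n R x y)

/-- symmetrisation: a direction-`μ` weighted sum of an orientation-symmetric non-negative bond quantity is at most
the (1.3)-weighted sum. [folklore] -/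
theorem sum_dirWt_le_sum_regWt (n : ℕ) (R : Finset (Fin (d + 1) → ℤ)) (μ : Fin (d + 1)) (t : ↥R → ↥R → ℝ)
    (htnn : ∀ x y, 0 ≤ t x y) (hsym : ∀ x y : ↥R, x.1 = y.1 + e1 μ → t y x = t x y) :
    ∑ x, ∑ y, dirWt n R μ x y * t x y ≤ ∑ x, ∑ y, regWt n R x y * t x y := by
  have hterm : ∀ x y : ↥R, dirWt n R μ y x * t y x = dirWt n R μ y x * t x y := by
    intro x y
    by_cases h : x.1 = y.1 + e1 μ
    · rw [hsym x y h]
    · simp only [dirWt, if_neg h, zero_mul]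
  have hswap : ∑ x, ∑ y, dirWt n R μ x y * t x y = ∑ x, ∑ y, dirWt n R μ y x * t x y := by
    rw [Finset.sum_comm]
    exact Finset.sum_congr rfl fun x _ => Finset.sum_congr rfl fun y _ => hterm x y
  have hw : ∀ x y, (dirWt n R μ x y + dirWt n R μ y x) * t x y ≤ 2 * regWt n R x y * t x y :=
    fun x y => mul_le_mul_of_nonneg_right (dirWt_add_rev_le n R μ x y) (htnn x y)
  have key : 2 * ∑ x, ∑ y, dirWt n R μ x y * t x y ≤ 2 * ∑ x, ∑ y, regWt n R x y * t x y :=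
    calc 2 * ∑ x, ∑ y, dirWt n R μ x y * t x y
        = ∑ x, ∑ y, dirWt n R μ x y * t x y + ∑ x, ∑ y, dirWt n R μ y x * t x y := by rw [← hswap]; ring
      _ = ∑ x, ∑ y, (dirWt n R μ x y + dirWt n R μ y x) * t x y := by
          rw [← Finset.sum_add_distrib]
          refine Finset.sum_congr rfl fun x _ => ?_
          rw [← Finset.sum_add_distrib]
          exact Finset.sum_congr rfl fun y _ => by ring
      _ ≤ ∑ x, ∑ y, 2 * regWt n R x y * t x y :=
          Finset.sum_le_sum fun x _ => Finset.sum_le_sum fun y _ => hw x y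
      _ = 2 * ∑ x, ∑ y, regWt n R x y * t x y := by
          rw [Finset.mul_sum]
          refine Finset.sum_congr rfl fun x _ => ?_
          rw [Finset.mul_sum]
          exact Finset.sum_congr rfl fun y _ => by ring
  linarith

/-- **`‖D^η_{W,μ}φ‖₂² ≤ ⟨φ, (−Δ_W)φ⟩`** on any region, for link variables that are orthogonal and reverse by
transposition (`W(y,x) = W(x,y)ᵀ`, as `U(A_b)` for a vector field: `A_{⟨y,x⟩} = −A_{⟨x,y⟩}`): the direction-`μ` bonds
are among the bonds of (1.3). [cite: Balaban1983RegularityDecay, p. 572 (1.3); p. 580 (2.29)] -/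
theorem covDeriv_sq_le_covLap_form (n : ℕ) (R : Finset (Fin (d + 1) → ℤ)) {W : ↥R → ↥R → Matrix ι ι ℝ}
    (hT : ∀ x y : ↥R, y.1 ∈ nbrs x.1 → W y x = (W x y)ᵀ) (hO : ∀ x y : ↥R, (W x y)ᵀ * W x y = 1)
    (μ : Fin (d + 1)) (Φ : ↥R × ι → ℝ) :
    (covDeriv n R W μ *ᵥ Φ) ⬝ᵥ (covDeriv n R W μ *ᵥ Φ) ≤ Φ ⬝ᵥ (covLap (regWt n R) W *ᵥ Φ) := by
  rw [covDeriv_form, covLap_form, covLap_form]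
  refine sum_dirWt_le_sum_regWt n R μ
    (fun x y => (W x y *ᵥ fld Φ y - fld Φ x) ⬝ᵥ (W x y *ᵥ fld Φ y - fld Φ x))
    (fun x y => dotProduct_self_nonneg' _) (fun x y h => ?_)
  have hn : x.1 ∈ nbrs y.1 := mem_nbrs.2 ⟨μ, Or.inl h⟩
  exact (bond_sq_rev (hT y x hn) (hO y x) (fld Φ y) (fld Φ x)).symm

end Deriv

section B4Bounds

/-! ## §3 (2.15) for `−Δ^{η,N}_{A,□} + m² + a_kP_k(A)` on a finite union of unit blocks, `A` regular (1.7) -/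

open Literature.MathematicalPhysics.QuantumFieldTheory.Balaban1983to89.B4Reflection242 (nbrs mem_nbrs)
open Literature.MathematicalPhysics.QuantumFieldTheory.Balaban1983to89.B4Lower18 (fineDom mem_fineDom)

variable {d : ℕ} {ι : Type*} [Fintype ι] [DecidableEq ι]

/-- for a vector field (an antisymmetric bond function) the link variables reverse by transposition:
`U(A_{⟨y,x⟩}) = U(−A_{⟨x,y⟩}) = U(A_{⟨x,y⟩})ᵀ`. [cite: Balaban1983RegularityDecay, p. 572 (1.2)] -/
theorem fieldLink_rev (F : OrthFlow ι) (κ : ℝ) {X : Type*} {A : X → X → ℝ} {x y : X} (h : A y x = -A x y) :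
    fieldLink F κ A y x = (fieldLink F κ A x y)ᵀ := by
  show F.U (κ * A y x) = (F.U (κ * A x y))ᵀ
  rw [F.transpose_eq, h, mul_neg]

/-- a vector field in component form is an antisymmetric bond function: `A(x', x) = −A(x, x')`.
[cite: Balaban1983RegularityDecay, p. 572, dictionary] -/
theorem compField_rev (Ac : (Fin (d + 1) → ℤ) → Fin (d + 1) → ℝ) (x x' : Fin (d + 1) → ℤ) :
    compField Ac x' x = -compField Ac x x' := by
  unfold compField; ring

/-- **`‖D^η_{A,μ}Φ‖₂² ≤ ⟨Φ, (−Δ^{η,N}_{A,R} + m² + aP_k(A))Φ⟩`** on any region `R` (`m² ≥ 0`, `a ≥ 0`, `A` a vector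
field, i.e. antisymmetric on bonds, any block weights and contours): the operator inequality
`∂^{η*}_μ∂^η_μ ≤ −Δ^{η,N}_□ + m_k² + a_kP_k` inside (2.29), here at `A ≠ 0`.
[cite: Balaban1983RegularityDecay, p. 580 (2.29)] -/
theorem covDeriv_sq_le_b4Op_form (F : OrthFlow ι) (κ : ℝ) (n : ℕ) (R : Finset (Fin (d + 1) → ℤ)) {m2 a : ℝ}
    (hm : 0 ≤ m2) (ha : 0 ≤ a) {Y : Type*} [Fintype Y] (q : Y → ↥R → ℝ) (emb : Y → ↥R)
    (Γ : Y → ↥R → List ↥R) {A : ↥R → ↥R → ℝ} (hA : ∀ x y : ↥R, y.1 ∈ nbrs x.1 → A y x = -A x y)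
    (μ : Fin (d + 1)) (Φ : ↥R × ι → ℝ) :
    (covDeriv n R (fieldLink F κ A) μ *ᵥ Φ) ⬝ᵥ (covDeriv n R (fieldLink F κ A) μ *ᵥ Φ)
      ≤ Φ ⬝ᵥ (b4Op F κ (regWt n R) m2 a q emb Γ A *ᵥ Φ) := by
  rw [b4Op, covOp_form]
  have h1 := covDeriv_sq_le_covLap_form n R (W := fieldLink F κ A)
    (fun x y h => fieldLink_rev F κ (hA x y h)) (fun x y => F.orth _) μ Φ
  have h2 : 0 ≤ m2 * (Φ ⬝ᵥ Φ) := mul_nonneg hm (dotProduct_self_nonneg' Φ)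
  have h3 : 0 ≤ a * (Φ ⬝ᵥ (projOp q (contourTrans (fieldLink F κ A) emb Γ) *ᵥ Φ)) :=
    mul_nonneg ha (by rw [projOp_form]; exact dotProduct_self_nonneg' _)
  linarith

/-- [B4]'s operator `−Δ^{η,N}_{A,□} + m² + a_kP_k(A)` (1.6) on the fine region `□` over the unit labels `Ωc`, for a
vector field in component form `A_ν(x)` and charge `e` (coupling `eη = e/n`), `a_k = a·n^{-(d+1)}`, the block weights,
base points and staircase contours of `B4Lower18RegularRegion` — exactly the operator of
`B4Lower18RegularRegion.lower18_regular_region_printed`. [cite: Balaban1983RegularityDecay, p. 572 (1.6)] -/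
noncomputable def regionOp (F : OrthFlow ι) (e : ℝ) {n : ℕ} (hn : 1 ≤ n) (a m2 : ℝ)
    (Ωc : Finset (Fin (d + 1) → ℤ)) (Ac : (Fin (d + 1) → ℤ) → Fin (d + 1) → ℝ) :
    Matrix (↥(fineDom n Ωc) × ι) (↥(fineDom n Ωc) × ι) ℝ :=
  b4Op F (e / n) (regWt n (fineDom n Ωc)) m2 (a * ((n : ℝ) ^ (d + 1))⁻¹) (rBlkWt n Ωc (fineDom n Ωc))
    (rbaseEmb hn Ωc) (rstairContour hn Ωc) (fun u v => compField Ac u.1 v.1)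

/-- [B4]'s covariant derivative `D^η_{A,μ}` (1.3) on the fine region over `Ωc` for the vector field `A_ν(x)` and
charge `e`. [cite: Balaban1983RegularityDecay, p. 572 (1.3)] -/
noncomputable def regionDeriv (F : OrthFlow ι) (e : ℝ) (n : ℕ) (Ωc : Finset (Fin (d + 1) → ℤ))
    (Ac : (Fin (d + 1) → ℤ) → Fin (d + 1) → ℝ) (μ : Fin (d + 1)) :
    Matrix (↥(fineDom n Ωc) × ι) (↥(fineDom n Ωc) × ι) ℝ :=
  covDeriv n (fineDom n Ωc) (fieldLink F (e / n) fun u v => compField Ac u.1 v.1) μ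

/-- `‖D^η_{A,μ}Φ‖₂² ≤ ⟨Φ, (−Δ^{η,N}_{A,□} + m² + a_kP_k(A))Φ⟩` on the fine region (`a ≥ 0`, `m² ≥ 0`).
[cite: Balaban1983RegularityDecay, p. 580 (2.29)] -/
theorem regionDeriv_sq_le_form (F : OrthFlow ι) (e : ℝ) {n : ℕ} (hn : 1 ≤ n) {a m2 : ℝ} (ha : 0 ≤ a)
    (hm : 0 ≤ m2) (Ωc : Finset (Fin (d + 1) → ℤ)) (Ac : (Fin (d + 1) → ℤ) → Fin (d + 1) → ℝ)
    (μ : Fin (d + 1)) (Φ : ↥(fineDom n Ωc) × ι → ℝ) :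
    (regionDeriv F e n Ωc Ac μ *ᵥ Φ) ⬝ᵥ (regionDeriv F e n Ωc Ac μ *ᵥ Φ)
      ≤ Φ ⬝ᵥ (regionOp F e hn a m2 Ωc Ac *ᵥ Φ) :=
  covDeriv_sq_le_b4Op_form F (e / n) n (fineDom n Ωc) hm (by positivity) _ _ _
    (fun x y _ => compField_rev Ac x.1 y.1) μ Φ

section Printed

variable (F : OrthFlow ι) {ℓ : ℝ} (hℓ : 0 ≤ ℓ)
  (hLip : ∀ t (v : ι → ℝ), ((F.U t - 1) *ᵥ v) ⬝ᵥ ((F.U t - 1) *ᵥ v) ≤ (ℓ * t) ^ 2 * (v ⬝ᵥ v))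
  {e : ℝ} (he : 0 < e) {n : ℕ} (hn : 1 ≤ n) {a : ℝ} (ha : 0 < a) {m2 : ℝ} (hm : 0 ≤ m2)
  (Ωc : Finset (Fin (d + 1) → ℤ)) {Ac : (Fin (d + 1) → ℤ) → Fin (d + 1) → ℝ} {c β : ℝ} (hc : 0 ≤ c)
  (h17 : ∀ x ∈ fineDom n Ωc, ∀ μ ν : Fin (d + 1), |Ac (x + e1 μ) ν - Ac x ν| ≤ c * e ^ (β - 1) / n)
  (hsmall : ℓ ^ 2 * ((d + 1) * c * e ^ β) ^ 2 * (d + 1) * (1 + a * (d + 1)) ≤ min 2 a / 4)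

include hℓ hLip he ha hm hc h17 hsmall

omit hm in
/-- (1.8) for the region operator (node `B4Lower18RegularRegion`): `H ≥ (min(2,a)/4 + m²)I` as forms under (1.7)
and the smallness of `e`. [cite: Balaban1983RegularityDecay, p. 573 (1.8)] -/
theorem regionOp_form_ge (Φ : ↥(fineDom n Ωc) × ι → ℝ) :
    (min 2 a / 4 + m2) * (Φ ⬝ᵥ Φ) ≤ Φ ⬝ᵥ (regionOp F e hn a m2 Ωc Ac *ᵥ Φ) :=
  lower18_regular_region_printed F hℓ hLip he hn ha.le m2 Ωc hc h17 hsmall Φ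

/-- **LEMMA 2.1, (2.15)₁ at `A ≠ 0`**: `γ²‖G_k(□,A)f‖₂² ≤ ‖f‖₂²`, `γ = min(2,a)/4 + m²`, on an ARBITRARY finite union
`□` of unit blocks, for `A` regular in the printed sense (1.7) and `e` small.
[cite: Balaban1983RegularityDecay, Lemma 2.1 (2.15) p. 577; proof p. 580] -/
theorem green_sq_le_region (f : ↥(fineDom n Ωc) × ι → ℝ) :
    (min 2 a / 4 + m2) ^ 2 *
        (((regionOp F e hn a m2 Ωc Ac)⁻¹ *ᵥ f) ⬝ᵥ ((regionOp F e hn a m2 Ωc Ac)⁻¹ *ᵥ f)) ≤ f ⬝ᵥ f :=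
  inv_mulVec_sq_le (add_pos_of_pos_of_nonneg (div_pos (lt_min two_pos ha) four_pos) hm)
    (regionOp_form_ge F hℓ hLip he hn ha Ωc hc h17 hsmall) f

/-- **LEMMA 2.1, (2.15)₂ at `A ≠ 0`**: `γ‖D^η_{A,μ}G_k(□,A)f‖₂² ≤ ‖f‖₂²`.
[cite: Balaban1983RegularityDecay, Lemma 2.1 (2.15) p. 577; proof p. 580 (2.29)] -/
theorem deriv_green_sq_le_region (μ : Fin (d + 1)) (f : ↥(fineDom n Ωc) × ι → ℝ) :
    (min 2 a / 4 + m2) *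
        ((regionDeriv F e n Ωc Ac μ *ᵥ ((regionOp F e hn a m2 Ωc Ac)⁻¹ *ᵥ f)) ⬝ᵥ
          (regionDeriv F e n Ωc Ac μ *ᵥ ((regionOp F e hn a m2 Ωc Ac)⁻¹ *ᵥ f))) ≤ f ⬝ᵥ f :=
  deriv_green_sq_le (add_pos_of_pos_of_nonneg (div_pos (lt_min two_pos ha) four_pos) hm)
    (regionOp_form_ge F hℓ hLip he hn ha Ωc hc h17 hsmall)
    (regionDeriv_sq_le_form F e hn ha.le hm Ωc Ac μ) f

/-- **LEMMA 2.1, (2.15)₃ at `A ≠ 0`**: `γ‖G_k(□,A)D^{η*}_{A,μ}f‖₂² ≤ ‖f‖₂²` (`D^{η*}` = the `ℓ²` adjoint = transpose).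
[cite: Balaban1983RegularityDecay, Lemma 2.1 (2.15) p. 577; proof p. 580 (2.29)] -/
theorem green_derivT_sq_le_region (μ : Fin (d + 1)) (f : ↥(fineDom n Ωc) × ι → ℝ) :
    (min 2 a / 4 + m2) *
        (((regionOp F e hn a m2 Ωc Ac)⁻¹ *ᵥ ((regionDeriv F e n Ωc Ac μ)ᵀ *ᵥ f)) ⬝ᵥ
          ((regionOp F e hn a m2 Ωc Ac)⁻¹ *ᵥ ((regionDeriv F e n Ωc Ac μ)ᵀ *ᵥ f))) ≤ f ⬝ᵥ f :=
  green_derivT_sq_le (add_pos_of_pos_of_nonneg (div_pos (lt_min two_pos ha) four_pos) hm)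
    (regionOp_form_ge F hℓ hLip he hn ha Ωc hc h17 hsmall)
    (regionDeriv_sq_le_form F e hn ha.le hm Ωc Ac μ) f

/-- **LEMMA 2.1, (2.15)₄ at `A ≠ 0`**: `‖D^η_{A,μ}G_k(□,A)D^{η*}_{A,ν}f‖₂² ≤ ‖f‖₂²`.
[cite: Balaban1983RegularityDecay, Lemma 2.1 (2.15) p. 577; proof p. 580 (2.29)] -/
theorem deriv_green_derivT_sq_le_region (μ ν : Fin (d + 1)) (f : ↥(fineDom n Ωc) × ι → ℝ) :
    (regionDeriv F e n Ωc Ac μ *ᵥ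
          ((regionOp F e hn a m2 Ωc Ac)⁻¹ *ᵥ ((regionDeriv F e n Ωc Ac ν)ᵀ *ᵥ f))) ⬝ᵥ
        (regionDeriv F e n Ωc Ac μ *ᵥ
          ((regionOp F e hn a m2 Ωc Ac)⁻¹ *ᵥ ((regionDeriv F e n Ωc Ac ν)ᵀ *ᵥ f))) ≤ f ⬝ᵥ f :=
  deriv_green_derivT_sq_le (add_pos_of_pos_of_nonneg (div_pos (lt_min two_pos ha) four_pos) hm)
    (regionOp_form_ge F hℓ hLip he hn ha Ωc hc h17 hsmall)
    (regionDeriv_sq_le_form F e hn ha.le hm Ωc Ac μ) (regionDeriv_sq_le_form F e hn ha.le hm Ωc Ac ν) f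

end Printed

end B4Bounds

section Family

/-! ## §4 The typed statement `B4.Lemma21Printed` on the family of regular-field regions -/

open Literature.MathematicalPhysics.QuantumFieldTheory.Balaban1983to89.B4 (CubeSetting Lemma21Printed)
open Literature.MathematicalPhysics.QuantumFieldTheory.Balaban1983to89.B4Reflection242 (blk boxDom mem_boxDom)
open Literature.MathematicalPhysics.QuantumFieldTheory.Balaban1983to89.B4Lower18 (fineDom mem_fineDom IsBlockUnion
  fineDom_boxDom boxDom_isBlockUnion)

variable {ι : Type} {d : ℕ}

/-- the Euclidean length `|v|` of a site value `v ∈ ℝ^N`. [folklore] -/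
noncomputable def siteNorm [Fintype ι] (v : ι → ℝ) : ℝ := Real.sqrt (v ⬝ᵥ v)

/-- AN INSTANCE of the Lemma-2.1 family: a regular-region instance (scale `n ≥ 1`, unit labels `Ωc` — `□` is the
fine region over `Ωc` —, charge `e`, vector field `A_ν(x)` in component form) together with a mass `m² ≥ 0`;
NO further hypothesis. [folklore] -/
structure RegularCubeInstance (d : ℕ) extends RegularRegionInstance d where
  m2 : ℝ
  hm : 0 ≤ m2

namespace RegularCubeInstance

variable [Fintype ι] [DecidableEq ι] (i : RegularCubeInstance d) (F : OrthFlow ι) (a : ℝ)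

/-- `G_k(□,A) = (−Δ^{η,N}_{A,□} + m² + a_kP_k(A))⁻¹` of the instance (flow `F`, constant `a`).
[cite: Balaban1983RegularityDecay, p. 572 (1.6)] -/
noncomputable def green : Matrix (↥(fineDom i.n i.Ωc) × ι) (↥(fineDom i.n i.Ωc) × ι) ℝ :=
  (regionOp F i.e i.hn a i.m2 i.Ωc i.Ac)⁻¹

/-- `D^η_{A,μ}` of the instance. [cite: Balaban1983RegularityDecay, p. 572 (1.3)] -/
noncomputable def deriv (μ : Fin (d + 1)) : Matrix (↥(fineDom i.n i.Ωc) × ι) (↥(fineDom i.n i.Ωc) × ι) ℝ :=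
  regionDeriv F i.e i.n i.Ωc i.Ac μ

/-- the four operators of (2.15) applied to `f`: `G f`, `D_μG f`, `GD_μ^* f`, `D_μGD_ν^* f` (`k = 0, 1, 2, 3`;
`D^{η*}` = the `ℓ²`-adjoint = transpose). [cite: Balaban1983RegularityDecay, p. 577 (2.15)] -/
noncomputable def opX (k : Fin 4) (μ ν : Fin (d + 1)) (f : ↥(fineDom i.n i.Ωc) × ι → ℝ) :
    ↥(fineDom i.n i.Ωc) × ι → ℝ :=
  match k.val with
  | 0 => i.green F a *ᵥ f
  | 1 => i.deriv F μ *ᵥ (i.green F a *ᵥ f)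
  | 2 => i.green F a *ᵥ ((i.deriv F μ)ᵀ *ᵥ f)
  | _ => i.deriv F μ *ᵥ (i.green F a *ᵥ ((i.deriv F ν)ᵀ *ᵥ f))

/-- the three operators of (2.17) applied to `f`: `G f`, `D_μG f`, `GD_μ^* f` (`k = 0, 1, 2`).
[cite: Balaban1983RegularityDecay, p. 578 (2.17)] -/
noncomputable def opY (k : Fin 3) (μ : Fin (d + 1)) (f : ↥(fineDom i.n i.Ωc) × ι → ℝ) :
    ↥(fineDom i.n i.Ωc) × ι → ℝ :=
  match k.val with
  | 0 => i.green F a *ᵥ f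
  | 1 => i.deriv F μ *ᵥ (i.green F a *ᵥ f)
  | _ => i.green F a *ᵥ ((i.deriv F μ)ᵀ *ᵥ f)

/-- `‖f‖_p` with `p = 1/s` and the lattice weight `η^{d+1}` per site (`s = 0`: the sup norm) — a DEFINITION ONLY
(the Lemma 2.2 side of the carrier; not read by `Lemma21Printed`). [cite: Balaban1983RegularityDecay, p. 578 (2.17)] -/
noncomputable def lpN (s : ℝ) (f : ↥(fineDom i.n i.Ωc) × ι → ℝ) : ℝ :=
  if s = 0 then ⨆ x, siteNorm (fld f x)
  else (((i.n : ℝ)⁻¹) ^ (d + 1) * ∑ x, siteNorm (fld f x) ^ (1 / s)) ^ s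

/-- `k = 0`: `G f`. [folklore] -/
theorem opX_zero (μ ν : Fin (d + 1)) (f : ↥(fineDom i.n i.Ωc) × ι → ℝ) :
    i.opX F a 0 μ ν f = i.green F a *ᵥ f := rfl

/-- `k = 1`: `D_μ G f`. [folklore] -/
theorem opX_one (μ ν : Fin (d + 1)) (f : ↥(fineDom i.n i.Ωc) × ι → ℝ) :
    i.opX F a 1 μ ν f = i.deriv F μ *ᵥ (i.green F a *ᵥ f) := rfl

/-- `k = 2`: `G D_μ^* f`. [folklore] -/
theorem opX_two (μ ν : Fin (d + 1)) (f : ↥(fineDom i.n i.Ωc) × ι → ℝ) :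
    i.opX F a 2 μ ν f = i.green F a *ᵥ ((i.deriv F μ)ᵀ *ᵥ f) := rfl

/-- `k = 3`: `D_μ G D_ν^* f`. [folklore] -/
theorem opX_three (μ ν : Fin (d + 1)) (f : ↥(fineDom i.n i.Ωc) × ι → ℝ) :
    i.opX F a 3 μ ν f = i.deriv F μ *ᵥ (i.green F a *ᵥ ((i.deriv F ν)ᵀ *ᵥ f)) := rfl

end RegularCubeInstance

/-- **THE CARRIER of `B4.CubeSetting` for Lemma 2.1 at `A ≠ 0`** (flow `F`, the constants `a, c, β` and the
large-block data `M, K` are family parameters): `Src` = fields on the fine points of `□` with values in `ℝ^N`,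
`Dir` = the `d+1` lattice directions, `e` = the instance's charge; `fewLargeBlocks` := «an arbitrary sum of unit
blocks, but such that it is a sum of at most few large blocks» typed as "`□` is a union of `M`-blocks with at most
`K` large-block labels" (typed faithfully, NOT USED by the certificate); `regular` := the printed (1.7) in lattice
units, `|A_ν(x + e_μ) − A_ν(x)| ≤ c e^{β−1}/n` on `□`; `l2Norm f = ‖f‖₂` (counting measure; (2.15) is homogeneous,
the weight `η^{d+1}` cancels); `opL2 k μ ν f` = the `ℓ²` norms of `G f`, `D_μG f`, `GD_μ^* f`, `D_μGD_ν^* f` with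
`G = G_k(□,A)`, `a_k = a·n^{-(d+1)}`, mass `m²`, coupling `e/n`, staircase contours.  The Lemma 2.2 side (`rect`,
`constNearBdry`, `supNorm`, `lpNorm`, `opLq`) is filled with its meaning as DEFINITIONS ONLY; `holder1` (the Hölder
norm (2.14), which needs the contours `Γ_{x,x'}`) is NOT MODELLED and set to `0` — `Lemma22Printed` must not be read on
this carrier. [cite: Balaban1983RegularityDecay, (2.14)–(2.15) p. 577] -/
noncomputable def regularCube [Fintype ι] [DecidableEq ι] (F : OrthFlow ι) (a c β : ℝ) (M K : ℕ)
    (i : RegularCubeInstance d) : CubeSetting where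
  Src := ↥(fineDom i.n i.Ωc) × ι → ℝ
  Dir := Fin (d + 1)
  e := i.e
  fewLargeBlocks := IsBlockUnion (M * i.n) (fineDom i.n i.Ωc) ∧ ((fineDom i.n i.Ωc).image (blk (M * i.n))).card ≤ K
  rect := ∃ l u : Fin (d + 1) → ℤ, ∀ x : Fin (d + 1) → ℤ, x ∈ fineDom i.n i.Ωc ↔ ∀ j, l j ≤ x j ∧ x j ≤ u j
  regular := ∀ x ∈ fineDom i.n i.Ωc, ∀ μ ν : Fin (d + 1), |i.Ac (x + e1 μ) ν - i.Ac x ν| ≤ c * i.e ^ (β - 1) / i.n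
  constNearBdry := ∃ A₀ : Fin (d + 1) → ℝ, ∀ x ∈ fineDom i.n i.Ωc,
    (∃ μ : Fin (d + 1), x + e1 μ ∉ fineDom i.n i.Ωc ∨ x - e1 μ ∉ fineDom i.n i.Ωc) → i.Ac x = A₀
  l2Norm := fun f => Real.sqrt (f ⬝ᵥ f)
  supNorm := fun f => ⨆ x, siteNorm (fld f x)
  lpNorm := fun s f => i.lpN s f
  opL2 := fun k μ ν f => Real.sqrt ((i.opX F a k μ ν f) ⬝ᵥ (i.opX F a k μ ν f))
  holder1 := fun _ _ => 0
  opLq := fun k μ t f => i.lpN t (i.opY F a k μ f)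

/-- the typed «few large blocks» antecedent of instance `i` reads: `□` is a union of `M`-blocks with at most `K`
large-block labels. [folklore] -/
theorem regularCube_fewLargeBlocks_iff [Fintype ι] [DecidableEq ι] (F : OrthFlow ι) (a c β : ℝ) (M K : ℕ)
    (i : RegularCubeInstance d) :
    (regularCube F a c β M K i).fewLargeBlocks ↔
      IsBlockUnion (M * i.n) (fineDom i.n i.Ωc) ∧ ((fineDom i.n i.Ωc).image (blk (M * i.n))).card ≤ K :=
  Iff.rfl

/-- the typed «let A be as in the theorem» antecedent of instance `i` is the printed regularity (1.7) in lattice units.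
[cite: Balaban1983RegularityDecay, p. 573 (1.7)] -/
theorem regularCube_regular_iff [Fintype ι] [DecidableEq ι] (F : OrthFlow ι) (a c β : ℝ) (M K : ℕ)
    (i : RegularCubeInstance d) :
    (regularCube F a c β M K i).regular ↔
      ∀ x ∈ fineDom i.n i.Ωc, ∀ μ ν : Fin (d + 1), |i.Ac (x + e1 μ) ν - i.Ac x ν| ≤ c * i.e ^ (β - 1) / i.n :=
  Iff.rfl

/-- scaling `γ²p ≤ q` (`γ ≥ γ₀ > 0`) to `p ≤ γ₀⁻²q`. [folklore] -/
theorem scale_sq {γ₀ γ p q : ℝ} (h0 : 0 < γ₀) (hle : γ₀ ≤ γ) (hp : 0 ≤ p) (h : γ ^ 2 * p ≤ q) :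
    p ≤ γ₀⁻¹ ^ 2 * q := by
  have h1 : γ₀ ^ 2 * p ≤ q := le_trans (mul_le_mul_of_nonneg_right (pow_le_pow_left₀ h0.le hle 2) hp) h
  rw [inv_pow, ← div_eq_inv_mul, le_div_iff₀ (pow_pos h0 2)]
  linarith

/-- scaling `γp ≤ q` (`γ ≥ γ₀`, `0 < γ₀ ≤ 1`) to `p ≤ γ₀⁻²q`. [folklore] -/
theorem scale_one {γ₀ γ p q : ℝ} (h0 : 0 < γ₀) (h1 : γ₀ ≤ 1) (hle : γ₀ ≤ γ) (hp : 0 ≤ p) (h : γ * p ≤ q) :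
    p ≤ γ₀⁻¹ ^ 2 * q := by
  have h2 : γ₀ * p ≤ q := le_trans (mul_le_mul_of_nonneg_right hle hp) h
  have h3 : γ₀ ^ 2 * p ≤ γ₀ * p := by
    have := mul_le_mul_of_nonneg_right h1 (mul_nonneg h0.le hp)
    nlinarith
  rw [inv_pow, ← div_eq_inv_mul, le_div_iff₀ (pow_pos h0 2)]
  linarith

/-- scaling `p ≤ q` (`q ≥ 0`, `0 < γ₀ ≤ 1`) to `p ≤ γ₀⁻²q`. [folklore] -/
theorem scale_zero {γ₀ p q : ℝ} (h0 : 0 < γ₀) (h1 : γ₀ ≤ 1) (hq : 0 ≤ q) (h : p ≤ q) :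
    p ≤ γ₀⁻¹ ^ 2 * q := by
  have h2 : γ₀ ^ 2 ≤ 1 := pow_le_one₀ h0.le h1
  have h3 : q * γ₀ ^ 2 ≤ q := mul_le_of_le_one_right hq h2
  have h4 : p * γ₀ ^ 2 ≤ q * γ₀ ^ 2 := mul_le_mul_of_nonneg_right h (sq_nonneg _)
  rw [inv_pow, ← div_eq_inv_mul, le_div_iff₀ (pow_pos h0 2)]
  linarith

/-- **LEMMA 2.1 (2.15) — THE TYPED STATEMENT `B4.Lemma21Printed` DISCHARGED AT `A ≠ 0`** on the family of ALL
regular-field regions (every mesh `n ≥ 1`, every finite union `□` of unit blocks, every mass `m² ≥ 0`, every charge,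
every vector field `A_ν(x)`), for a flow `U(t) = e^{tq}` with `|U(t) − 1| ≤ ℓ|t|`, `a > 0`, `c ≥ 0`, `β > 0` and any
large-block data `M, K`: with `c₂ = 4/min(2,a)` and the threshold `e₁(ℓ, d, c, β, a)` of
`B4Lower18Regular.threshold_exists` (chosen BEFORE the instance), every instance whose field is regular in the
printed sense (1.7) with constant `c` and whose charge satisfies `0 < e ≤ e₁` obeys the four bounds (2.15).  The
antecedent «few large blocks» is not used (our bound is uniform in `□`).
[cite: Balaban1983RegularityDecay, Lemma 2.1 (2.15) p. 577; proof pp. 579–580] -/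
theorem lemma21Printed_regularRegion [Fintype ι] [DecidableEq ι] (F : OrthFlow ι) {ℓ : ℝ} (hℓ : 0 ≤ ℓ)
    (hLip : ∀ t (v : ι → ℝ), ((F.U t - 1) *ᵥ v) ⬝ᵥ ((F.U t - 1) *ᵥ v) ≤ (ℓ * t) ^ 2 * (v ⬝ᵥ v))
    {a : ℝ} (ha : 0 < a) {c : ℝ} (hc : 0 ≤ c) {β : ℝ} (hβ : 0 < β) (M K : ℕ) :
    Lemma21Printed (regularCube (d := d) F a c β M K) := by
  obtain ⟨e₁, he₁, hsm⟩ := threshold_exists ℓ ((d + 1) * c) ha hβ d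
  have hγ0 : 0 < min 2 a / 4 := div_pos (lt_min two_pos ha) four_pos
  have hγ1 : min 2 a / 4 ≤ 1 := by have := min_le_left 2 a; linarith
  refine ⟨(min 2 a / 4)⁻¹, e₁, inv_pos.2 hγ0, he₁, ?_⟩
  intro i _ hreg he hle k μ ν f
  change 0 < i.e at he
  change i.e ≤ e₁ at hle
  rw [regularCube_regular_iff] at hreg
  have hsm' : ℓ ^ 2 * ((d + 1) * c * i.e ^ β) ^ 2 * (d + 1) * (1 + a * (d + 1)) ≤ min 2 a / 4 := by
    have := hsm i.e he hle
    simpa only [mul_assoc] using this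
  have hγle : min 2 a / 4 ≤ min 2 a / 4 + i.m2 := le_add_of_nonneg_right i.hm
  have hff : 0 ≤ f ⬝ᵥ f := dotProduct_self_nonneg' f
  have key : (i.opX F a k μ ν f) ⬝ᵥ (i.opX F a k μ ν f) ≤ (min 2 a / 4)⁻¹ ^ 2 * (f ⬝ᵥ f) := by
    have hk : k = 0 ∨ k = 1 ∨ k = 2 ∨ k = 3 := by fin_cases k <;> simp
    rcases hk with rfl | rfl | rfl | rfl
    · rw [RegularCubeInstance.opX_zero]
      exact scale_sq hγ0 hγle (dotProduct_self_nonneg' _)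
        (green_sq_le_region F hℓ hLip he i.hn ha i.hm i.Ωc hc hreg hsm' f)
    · rw [RegularCubeInstance.opX_one]
      exact scale_one hγ0 hγ1 hγle (dotProduct_self_nonneg' _)
        (deriv_green_sq_le_region F hℓ hLip he i.hn ha i.hm i.Ωc hc hreg hsm' μ f)
    · rw [RegularCubeInstance.opX_two]
      exact scale_one hγ0 hγ1 hγle (dotProduct_self_nonneg' _)
        (green_derivT_sq_le_region F hℓ hLip he i.hn ha i.hm i.Ωc hc hreg hsm' μ f)
    · rw [RegularCubeInstance.opX_three]
      exact scale_zero hγ0 hγ1 hff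
        (deriv_green_derivT_sq_le_region F hℓ hLip he i.hn ha i.hm i.Ωc hc hreg hsm' μ ν f)
  show Real.sqrt ((i.opX F a k μ ν f) ⬝ᵥ (i.opX F a k μ ν f)) ≤ (min 2 a / 4)⁻¹ * Real.sqrt (f ⬝ᵥ f)
  calc Real.sqrt ((i.opX F a k μ ν f) ⬝ᵥ (i.opX F a k μ ν f))
      ≤ Real.sqrt ((min 2 a / 4)⁻¹ ^ 2 * (f ⬝ᵥ f)) := Real.sqrt_le_sqrt key
    _ = (min 2 a / 4)⁻¹ * Real.sqrt (f ⬝ᵥ f) := by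
        rw [Real.sqrt_mul (sq_nonneg _), Real.sqrt_sq (inv_nonneg.2 hγ0.le)]

/-- Lemma 2.1 typed on the regular-region family for the ROTATION FLOW (`N = 2`, `ℓ = 1`): a hypothesis-free
instance of the flow assumptions. [cite: Balaban1983RegularityDecay, Lemma 2.1 (2.15) p. 577] -/
theorem lemma21Printed_regularRegion_rot {a : ℝ} (ha : 0 < a) {c : ℝ} (hc : 0 ≤ c) {β : ℝ} (hβ : 0 < β)
    (M K : ℕ) : Lemma21Printed (regularCube (d := d) OrthFlow.rot a c β M K) :=
  lemma21Printed_regularRegion OrthFlow.rot zero_le_one rot_lipschitz ha hc hβ M K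

/-! ### Non-vacuity: the antecedents are met below every threshold, by non-constant fields -/

/-- THE LINEAR-FIELD CUBE INSTANCE: mesh `1/n`, `□` = the fine region over the large block `[0,M)^{d+1}` of unit
labels, mass `m²`, charge `e`, and the NON-CONSTANT vector field `A_ν(x) = λ·x_0` (every component grows linearly
in the first coordinate). [folklore] -/
noncomputable def linInst (d : ℕ) {n : ℕ} (hn : 1 ≤ n) (M : ℕ) {m2 : ℝ} (hm : 0 ≤ m2) (lam e : ℝ) :
    RegularCubeInstance d where
  n := n
  hn := hn
  Ωc := boxDom fun _ => M
  e := e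
  Ac := fun x _ => lam * ((x 0 : ℤ) : ℝ)
  m2 := m2
  hm := hm

/-- every fine point of the fine region over `[0,M)^{d+1}` has large-block (`Mn`-block) label `0`. [folklore] -/
theorem blk_large_eq_zero {n M : ℕ} (hn : 1 ≤ n) {x : Fin (d + 1) → ℤ}
    (hx : x ∈ fineDom n (boxDom fun _ : Fin (d + 1) => M)) : blk (M * n) x = 0 := by
  rw [fineDom_boxDom hn, mem_boxDom] at hx
  funext j
  obtain ⟨h1, h2⟩ := hx j
  show x j / ((M * n : ℕ) : ℤ) = 0
  push_cast at h2 ⊢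
  exact Int.ediv_eq_zero_of_lt h1 (by rw [mul_comm]; exact h2)

/-- **NON-VACUITY OF THE TYPED HEADLINE**: for EVERY threshold `e₁ > 0`, every `M ≥ 1`, `K ≥ 1`, every mesh and
every mass, the linear-field cube instance with charge `e₁` and slope `λ = c e₁^{β−1}/n` meets every antecedent of
`Lemma21Printed` on the carrier — «few large blocks», regular (1.7) with constant `c`, `0 < e ≤ e₁` — so the
threshold `e₁` of `lemma21Printed_regularRegion` excludes no scale, region size or mass, and the conclusion is
asserted for genuinely non-zero fields. [folklore] -/
theorem linInst_meets [Fintype ι] [DecidableEq ι] (F : OrthFlow ι) (a : ℝ) {c : ℝ} (hc : 0 ≤ c) (β : ℝ)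
    {M K : ℕ} (hM : 1 ≤ M) (hK : 1 ≤ K) {n : ℕ} (hn : 1 ≤ n) {m2 : ℝ} (hm : 0 ≤ m2) {e₁ : ℝ} (he₁ : 0 < e₁) :
    (regularCube F a c β M K (linInst d hn M hm (c * e₁ ^ (β - 1) / n) e₁)).fewLargeBlocks ∧
      (regularCube F a c β M K (linInst d hn M hm (c * e₁ ^ (β - 1) / n) e₁)).regular ∧
      0 < (regularCube F a c β M K (linInst d hn M hm (c * e₁ ^ (β - 1) / n) e₁)).e ∧
      (regularCube F a c β M K (linInst d hn M hm (c * e₁ ^ (β - 1) / n) e₁)).e ≤ e₁ := by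
  refine ⟨⟨?_, ?_⟩, ?_, he₁, le_rfl⟩
  · show IsBlockUnion (M * n) (fineDom n (boxDom fun _ : Fin (d + 1) => M))
    rw [fineDom_boxDom hn]
    have h1 : 1 ≤ M * n := Nat.succ_le_of_lt (Nat.mul_pos hM hn)
    have hfun : (fun _ : Fin (d + 1) => n * M) = fun _ => M * n * 1 := funext fun _ => by ring
    rw [hfun]
    exact boxDom_isBlockUnion h1 fun _ => 1
  · show ((fineDom n (boxDom fun _ : Fin (d + 1) => M)).image (blk (M * n))).card ≤ K
    refine le_trans (Finset.card_le_one.2 ?_) hK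
    intro u hu v hv
    rw [Finset.mem_image] at hu hv
    obtain ⟨x, hx, rfl⟩ := hu
    obtain ⟨y, hy, rfl⟩ := hv
    rw [blk_large_eq_zero hn hx, blk_large_eq_zero hn hy]
  · intro x _ μ ν
    show |c * e₁ ^ (β - 1) / n * (((x + e1 μ) 0 : ℤ) : ℝ) - c * e₁ ^ (β - 1) / n * ((x 0 : ℤ) : ℝ)|
      ≤ c * e₁ ^ (β - 1) / n
    have hlam : 0 ≤ c * e₁ ^ (β - 1) / n := by positivity
    rw [← mul_sub, abs_mul, abs_of_nonneg hlam]
    apply mul_le_of_le_one_right hlam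
    simp only [Pi.add_apply, Int.cast_add, add_sub_cancel_left]
    by_cases h : (0 : Fin (d + 1)) = μ
    · subst h; rw [e1_apply_self]; simp
    · rw [e1_apply_ne h]; simp

end Family

end Literature.MathematicalPhysics.QuantumFieldTheory.Balaban1983to89.B4Lemma21Region
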